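/-
Copyright: cell `pub-ymgap` (HUMAN RULING D-0062), Track A of `YM-PLAN.md`, DAG node N20 (= NE7b); R134 acceleration seat
`pub-ymgap-dag-n20-c` (strategy s1, generation 7), module 41.  Released under the licence of the surrounding project.
-/
import Summits.QuantumFields.YangMills.Theorems.BalabanUVNodesN20LCSHullDisplay
import HarnessLib

/-!
# YM-DAG node N20 (= NE7b), row s1, module 41: BOTH NAMED PROPS ON BAŁABAN'S LABEL TOWER IN THE REPAIRED SHAPE — `PointwiseExtraction ∧
# LocCondStability` along a pattern pinned at the levels of `J`, from «LCS-j ON THE HULL OF WINDOW-ADMISSIBLE PINS» only (module 32 §1–§2 re-displayed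
# after modules 38–40), with the carrier switched OFF after the prefixes whose (3.2) window does not contain the pinned cubes

Track A of `YM-PLAN.md` (cell `pub-ymgap`, HUMAN RULING D-0062), node **N20** = spine estimate NE7b (`T4WeightBudget.RelWeightBound`, NOT
PRINTED, NOT PROVED).  Seat `pub-ymgap-dag-n20-c` (R134, s1), generation 7, module 41 (imports module 40 `…N20LCSHullDisplay`).  Kernel theorems
only: 0 `def`, 0 `sorry`, standard axioms; COUNT-NEUTRAL.

WHY.  The (α)-road's END record consumes the two NAMED `Prop`s of `Spine/NE7b/LocalConditionalStability` (`pwA`∕`lcsA`), which module 32 inhabited on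
the label tower of record modulo «LCS-j ∀ X, ∀ h» — the display module 38 shows over-strong.  THIS FILE inhabits them modulo the REPAIRED «LCS-j» of
module 40 (asked only for prefixes `h` with `D_j ⊆ cubes32 j (seqOfHist j h)` and only for `X` inside the hull of `⋃_{c∈D_j} R_j c`), with the
HISTORY-DEPENDENT carrier `M j h = 𝟙[D_j ⊆ cubes32 j (seqOfHist j h)] · 𝟙_{S_j}` (`S_j` the pinned coarse large-field event) at the pinned levels:
* §1 `ωOfRecord_eq_zero_of_not_subset_cubes32`, `labelChi_eq_zero_of_not_subset_cubes32` — after an off-window prefix every label pinning `D` has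
  weight ZERO pointwise (def-T's `aWeight` carries the indicator `[P ⊆ cubes32 s]`), so the extraction half holds there with the zero carrier;
  `setIntegral_event_eterm_le_of_LCS_hull` — module 32 §1 (the `μ_k`-mass of a term on the pinned event) from «LCS-k on the hull» (module 39);
* §2 ★★★ **`halves_rec_pinnedLevels_hullWindow`** — `PointwiseExtraction ∧ LocCondStability` at the residual of record for the pattern pinned at `J`, with
  the windowed indicator carriers, extracted exponents `0`, stability exponents `log (rate j)` at pinned levels — modulo `hreg` and THE REPAIRED WALL only.

HONEST FRAMING.  A RE-DISPLAY (module 32's proofs with modules 39∕40's inputs); no new estimate; «LCS-j on the hull of window-admissible pins» at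
`j ≥ 1`, level-uniform, is Bałaban's small-field analysis ((A1c)) and stays displayed; the key-pattern READING (NC-NE7b-α) and the geometric
separation of module 40's header stay located.  NE7b NOT PRINTED ∕ NOT PROVED; (α)-instance 0∕1; N20 NOT discharged; typed 28∕28, discharged count
untouched; one finite four-torus at fixed `ε` — NOT ℝ⁴, NOT infinite volume, NOT OS, NOT a mass gap, NOT Clay.

References (LOCATORS): T. Bałaban, CMP 119 (1988) 243–285 [Balaban1988Convergent] ((3.2)–(3.5) p. 265); CMP 122 (1989) 175–202
[Balaban1989LargeFieldI] ((0.1) p. 175, (0.3)–(0.5) pp. 176–177, (1.22)–(1.28) pp. 181–183); CMP 102 (1985) 277–309 [Balaban1985Variational] (Thm 1 p. 279).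
-/

set_option autoImplicit false

noncomputable section

open scoped BigOperators ENNReal

namespace Summit.QuantumFields.YangMills.BalabanUVNodes.N20LCSHullHalves

open MeasureTheory
open Literature.MathematicalPhysics.QuantumFieldTheory.Balaban1983to89
open Literature.MathematicalPhysics.QuantumFieldTheory.Balaban1983to89.T4Continuum
open Literature.MathematicalPhysics.QuantumFieldTheory.Balaban1983to89.B14.Eq218Concrete
open Literature.MathematicalPhysics.QuantumFieldTheory.Balaban1983to89.Node00
open Summit.QuantumFields.BalabanUV.T4Continuum.B16HistoryIndexedRepr (GoodClass)
open Summit.QuantumFields.BalabanUV.T4Continuum.B16HistoryReprChain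
open Summit.QuantumFields.BalabanUV.T4Continuum.NE7b.PrefixExtraction (admS)
open Summit.QuantumFields.BalabanUV.T4Continuum.NE7b.LocalConditionalStability (LocCondStability PointwiseExtraction)
open Summit.QuantumFields.YangMills.BalabanUVNodes.N20LCSLabelTower
open Summit.QuantumFields.YangMills.BalabanUVNodes.N20LCSLabelTowerClassWeight (labelChi_eq)
open Summit.QuantumFields.YangMills.BalabanUVNodes.N20LCSLabelTowerPinnedLevel
  (integral_lawOfRecord_eq measurable_rnDeriv_toReal integrable_rnDeriv_mul)
open Summit.QuantumFields.YangMills.BalabanUVNodes.N20LCSLargeFieldFamilies (measurableSet_forall_exists_largeField)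
open Summit.QuantumFields.YangMills.BalabanUVNodes.N20LCSLargeFieldSubfamilies (abs_sum_ωOfRecord_sub_le_indicator sum_ωOfRecord_sub_le)
open Summit.QuantumFields.YangMills.BalabanUVNodes.N20LCSLargeFieldSparsify (zeta_nonneg_of_laws)
open Summit.QuantumFields.YangMills.BalabanUVNodes.N20LCSAvgExpMoment (sq_div_le_one_sub_reTr_of_le_dist1)
open Summit.QuantumFields.YangMills.BalabanUVNodes.N20LCSAvgDominationRegion (boxRegion)
open Summit.QuantumFields.YangMills.BalabanUVNodes.N20LCSHullTransfer (setIntegral_forall_exists_le_of_moments_hull)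
open ExpMeanLog (expMeanLogSU deltaSU)
open BlockAveraging (avgFun)

variable (F : T4Family) (N : ℕ) [NeZero N] (ν : Stage7Numerics) (M : ℕ) (p : B12.RunParams) (g : ℕ → ℝ)

/-! ## §1 Off-window labels weigh zero pointwise; the `μ_k`-mass of a term on the pinned event from «LCS-k on the hull» -/

section OffWindow

variable (A₁ : ℝ) (ζ : ZetaOfRecord F N ν M)

/-- **OFF THE (3.2) WINDOW THE LABEL WEIGHT IS ZERO**: def-T's `aWeight` carries the indicator `[P ⊆ cubes32 s]`, so `ωOfRecord … s t U V′ = 0` whenever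
`t.1 ⊄ cubes32 k s`. [cite: Balaban1988Convergent, (3.2) p.265] -/
theorem ωOfRecord_eq_zero_of_not_subset_cubes32 (k : ℕ) (s : SeqOfRecord F ν M g p.K k) (t : LbOfRecord F ν p g k)
    (ht : ¬ t.1 ⊆ cubes32 F ν M p g k s) (U : cfgOfRecord F N p.K k) (V' : cfgOfRecord F N p.K (k + 1)) :
    ωOfRecord F N ν M p g k A₁ ζ s t U V' = 0 := by
  simp only [ωOfRecord, aWeight, if_neg ht, zero_mul]

/-- … hence the step kernel of the label tower vanishes after an off-window prefix at every label pinning `D ⊄ cubes32 k (seqOfHist k h)` (under the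
two ζ-laws, `labelChi = ω` read on the graph). [folklore] -/
theorem labelChi_eq_zero_of_not_subset_cubes32 (hζu : IsZetaUnity F N ν M ζ) (hζ : IsZetaAbsLeOne F N ν M ζ) (k : ℕ)
    (h : Fin k → LabelPat F ν p g) {D : Finset (Iχ F ν p g k)} (hD : ¬ D ⊆ cubes32 F ν M p g k (seqOfHist F ν M p g k h))
    (t : LbOfRecord F ν p g k) (ht : D ⊆ t.1) (U : cfgOfRecord F N p.K k) :
    labelChi F N ν M p g A₁ ζ k h ⟨k, t⟩ U = 0 := by
  rw [labelChi_eq F N ν M p g A₁ hζu hζ, labelAt_mk]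
  exact ωOfRecord_eq_zero_of_not_subset_cubes32 F N ν M p g A₁ ζ k _ t (fun hsub => hD (ht.trans hsub)) U _

end OffWindow

section PinnedHull

variable {A₁ : ℝ} {ζ : ZetaOfRecord F N ν M}

/-- ★★ **THE `μ_k`-MASS OF A HISTORY TERM ON THE COARSE LARGE-FIELD EVENT, FROM «LCS-k ON THE HULL»** (module 32 §1's `setIntegral_event_eterm_le_of_LCS`
with the moment hypothesis asked only for the `X` inside the hull of `⋃_{c∈D} R c`; proof of record with module 39's `setIntegral_forall_exists_le_of_moments_hull`).
[folklore] -/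
theorem setIntegral_event_eterm_le_of_LCS_hull (k : ℕ) (hk : k < p.K) {α : ℝ} (hα : 0 < α)
    (hguard : (((((F.P p.K).d + 2) * (F.P p.K).L : ℕ) : ℝ) ^ 2 / 4) * Real.sqrt (2 * (Fintype.card (Fin N) : ℝ) * α) <
      deltaSU (Fin N))
    {ρ₀ : cfgOfRecord F N p.K 0 → ℝ} (hρ : (bddMeas (cfgOfRecord F N p.K 0)).Gd ρ₀) (h0 : ∀ U, 0 ≤ ρ₀ U)
    (h : Fin k → LabelPat F ν p g) {β : ℝ} (hβ : 0 ≤ β) {C a₀ : ℝ} (hC : 0 ≤ C)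
    (D : Finset (Iχ F ν p g k)) (R : Iχ F ν p g k → Finset (Plaq (F.P p.K) (k + 1)))
    (hLS : ∀ a : ℝ, 0 ≤ a → a ≤ a₀ → ∀ X : Finset (Plaq (F.P p.K) k),
      (∀ q ∈ X, ∃ c ∈ D, ∃ p' ∈ R c, q ∈ boxRegion (emb p'.src) (((F.P p.K).d + 3) * (F.P p.K).L + 2)) →
      ∫ U, Real.exp (a * β * ∑ q ∈ X, (1 - reTr (GaugeField.plaqHol U q))) *
          (labelTowerOfRecord F N ν M p g A₁ ζ).eterm ρ₀ k h U ∂(lawOfRecord F N p.K k) ≤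
        Real.exp (C * a * X.card) * ∫ U, (labelTowerOfRecord F N ν M p g A₁ ζ).eterm ρ₀ k h U ∂(lawOfRecord F N p.K k))
    {δ : ℝ} (hδ0 : 0 ≤ δ)
    (hδ : δ * ((2 * (Fintype.card (Fin N) : ℝ) * (((F.P p.K).L : ℝ) ^ 2 + 6 * ((((F.P p.K).d + 2) * (F.P p.K).L : ℕ) : ℝ) ^ 2) ^ 2 + 2 / α) *
      (((2 * (((F.P p.K).d + 3) * (F.P p.K).L + 2) + 1) ^ (F.P p.K).d * (F.P p.K).d ^ 2 : ℕ) : ℝ)) ≤ a₀)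
    (m : ℕ) {ε'' : ℝ} (hε : 0 ≤ ε'')
    (hm : ∀ c ∈ D, (R c).card ≤ m) (hdisj : ∀ c₁ ∈ D, ∀ c₂ ∈ D, c₁ ≠ c₂ → Disjoint (R c₁) (R c₂)) :
    ∫ U in {U | ∀ c ∈ D, ∃ p' ∈ R c, ε'' ≤ dist1 (GaugeField.plaqHol ((avOfRecord F N p.K k).avg U) p')},
        (labelTowerOfRecord F N ν M p g A₁ ζ).eterm ρ₀ k h U ∂(lawOfRecord F N p.K k) ≤
      ((m : ℝ) * Real.exp (C * ((2 * (Fintype.card (Fin N) : ℝ) *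
            (((F.P p.K).L : ℝ) ^ 2 + 6 * ((((F.P p.K).d + 2) * (F.P p.K).L : ℕ) : ℝ) ^ 2) ^ 2 + 2 / α) *
          (((2 * (((F.P p.K).d + 3) * (F.P p.K).L + 2) + 1) ^ (F.P p.K).d * (F.P p.K).d ^ 2 : ℕ) : ℝ)) *
          (((2 * (((F.P p.K).d + 3) * (F.P p.K).L + 2) + 1) ^ (F.P p.K).d * (F.P p.K).d ^ 2 : ℕ) : ℝ) * δ -
            δ * β * (ε'' ^ 2 / (2 * (Fintype.card (Fin N) : ℝ))))) ^ D.card *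
        ∫ U, (labelTowerOfRecord F N ν M p g A₁ ζ).eterm ρ₀ k h U ∂(lawOfRecord F N p.K k) := by
  classical
  set T := labelTowerOfRecord F N ν M p g A₁ ζ with hT
  set e : cfgOfRecord F N p.K k → ℝ := T.eterm ρ₀ k h with he
  set dens : cfgOfRecord F N p.K k → ℝ := fun U => ((lawOfRecord F N p.K k).rnDeriv (fieldMeasure (F.P p.K) k (SU N)) U).toReal
    with hdens
  have hk' : k ≤ p.K := hk.le
  have hj : k + 1 ≤ (F.P p.K).m + (F.P p.K).K := by
    simp only [T4Family.P_m, T4Family.P_K]; omega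
  have hegood : (bddMeas (cfgOfRecord F N p.K k)).Gd e := T.eterm_good hρ k h
  have he0 : ∀ U, 0 ≤ e U := fun U => T.eterm_nonneg hρ h0 k h U
  have heint : Integrable e (lawOfRecord F N p.K k) := integrable_of_bddMeas _ hegood
  have hfm : Measurable fun U => dens U * e U := (measurable_rnDeriv_toReal F N p.K k).mul hegood.1
  have hf0 : ∀ U, 0 ≤ dens U * e U := fun U => mul_nonneg ENNReal.toReal_nonneg (he0 U)
  have hfi : Integrable (fun U => dens U * e U) (fieldMeasure (F.P p.K) k (SU N)) := integrable_rnDeriv_mul F N p.K k hk' heint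
  have hLS' : ∀ a : ℝ, 0 ≤ a → a ≤ a₀ → ∀ X : Finset (Plaq (F.P p.K) k),
      (∀ q ∈ X, ∃ c ∈ D, ∃ p' ∈ R c, q ∈ boxRegion (emb p'.src) (((F.P p.K).d + 3) * (F.P p.K).L + 2)) →
      ∫ U, Real.exp (a * β * ∑ q ∈ X, (1 - reTr (GaugeField.plaqHol U q))) * (dens U * e U) ∂(fieldMeasure (F.P p.K) k (SU N)) ≤
        Real.exp (C * a * X.card) * ∫ U, dens U * e U ∂(fieldMeasure (F.P p.K) k (SU N)) := by
    intro a ha ha0 X hX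
    have e1 : ∫ U, Real.exp (a * β * ∑ q ∈ X, (1 - reTr (GaugeField.plaqHol U q))) * (dens U * e U) ∂(fieldMeasure (F.P p.K) k (SU N)) =
        ∫ U, Real.exp (a * β * ∑ q ∈ X, (1 - reTr (GaugeField.plaqHol U q))) * e U ∂(lawOfRecord F N p.K k) := by
      rw [integral_lawOfRecord_eq F N p.K k hk']
      exact integral_congr_ae (ae_of_all _ fun U => by ring)
    rw [e1, ← integral_lawOfRecord_eq F N p.K k hk' e]
    exact hLS a ha ha0 X hX
  set S : Set (cfgOfRecord F N p.K k) :=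
    {U | ∀ c ∈ D, ∃ p' ∈ R c, ε'' ≤ dist1 (GaugeField.plaqHol ((avOfRecord F N p.K k).avg U) p')} with hS
  set S' : Set (cfgOfRecord F N p.K k) :=
    {U | ∀ c ∈ D, ∃ p' ∈ R c, ε'' ^ 2 / (2 * (Fintype.card (Fin N) : ℝ)) ≤
      1 - reTr (GaugeField.plaqHol (avgFun (expMeanLogSU (n := Fin N)) U) p')} with hS'
  have hsub : S ⊆ S' := by
    intro U hU c hc
    obtain ⟨p', hp', hle⟩ := hU c hc
    exact ⟨p', hp', sq_div_le_one_sub_reTr_of_le_dist1 _ hε hle⟩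
  have hSm : MeasurableSet S :=
    (measurableSet_forall_exists_largeField F N ν p g k D R ε'').preimage (avOfRecord_measurable F N p.K k)
  have h1 : ∫ U in S, e U ∂(lawOfRecord F N p.K k) = ∫ U in S, dens U * e U ∂(fieldMeasure (F.P p.K) k (SU N)) := by
    rw [← integral_indicator hSm, ← integral_indicator hSm, integral_lawOfRecord_eq F N p.K k hk']
    refine integral_congr_ae (ae_of_all _ fun U => ?_)
    show dens U * S.indicator e U = S.indicator (fun U => dens U * e U) U
    rw [Set.indicator_mul_right]
  have h2 : ∫ U in S, dens U * e U ∂(fieldMeasure (F.P p.K) k (SU N)) ≤ ∫ U in S', dens U * e U ∂(fieldMeasure (F.P p.K) k (SU N)) :=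
    setIntegral_mono_set hfi.integrableOn (ae_of_all _ hf0) (ae_of_all _ hsub)
  have h3 := setIntegral_forall_exists_le_of_moments_hull (N := N) hj hα hguard hfm hf0 hfi hβ hC D R hLS' hδ0 hδ
    (ε'' ^ 2 / (2 * (Fintype.card (Fin N) : ℝ))) m hm hdisj
  have h4 : ∫ U, dens U * e U ∂(fieldMeasure (F.P p.K) k (SU N)) = ∫ U, e U ∂(lawOfRecord F N p.K k) :=
    (integral_lawOfRecord_eq F N p.K k hk' e).symm
  rw [h1, ← h4]
  exact h2.trans h3

end PinnedHull

/-! ## §2 Both named Props along a pattern pinned at the levels of `J`, at the residual of record, from the REPAIRED wall -/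

section Halves

variable (A₁ : ℝ)

open Classical in
/-- ★★★ **`PointwiseExtraction ∧ LocCondStability` ALONG A LABEL PATTERN PINNED AT THE LEVELS OF `J`, ON BAŁABAN's LABEL TOWER AT THE RESIDUAL OF RECORD,
FROM «LCS-j ON THE HULL OF WINDOW-ADMISSIBLE PINS»** (module 35 §2's `halves_rec_pinnedLevels` in the repaired shape of module 38).  Data as there; the
carriers are the WINDOWED indicators `M j h U = 𝟙[D_j ⊆ cubes32 j (seqOfHist j h)]·𝟙[∀ □ ∈ D_j, ∃ p′ ∈ R_j □, ε″_j ≤ |avg_j U(∂p′) − 1|]` at the pinned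
levels (`1` elsewhere), extracted exponents `0`, stability exponents `log (rate j)` at pinned levels (`0` elsewhere); the ONE analytic hypothesis is
«LCS-j» for the prefixes `h` of the class WITH `D_j` inside their window and for the `X` inside the hull of `⋃_{c∈D_j} R_j c` only. [folklore] -/
theorem halves_rec_pinnedLevels_hullWindow {ρ₀ : cfgOfRecord F N p.K 0 → ℝ} (hρ : (bddMeas (cfgOfRecord F N p.K 0)).Gd ρ₀)
    (h0 : ∀ U, 0 ≤ ρ₀ U) (J : Finset ℕ) (hJ : ∀ j ∈ J, j < p.K)
    (D : (j : ℕ) → Finset (Iχ F ν p g j)) (R : (j : ℕ) → Iχ F ν p g j → Finset (Plaq (F.P p.K) (j + 1))) (m : ℕ → ℕ) (ε'' : ℕ → ℝ)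
    (hε : ∀ j ∈ J, 0 ≤ ε'' j) (hm : ∀ j ∈ J, ∀ c ∈ D j, (R j c).card ≤ m j)
    (hdisj : ∀ j ∈ J, ∀ c₁ ∈ D j, ∀ c₂ ∈ D j, c₁ ≠ c₂ → Disjoint (R j c₁) (R j c₂))
    (hreg : ∀ j ∈ J, ∀ c ∈ D j, ∀ V' : GaugeField (F.P p.K) (j + 1) (SU N),
      (∀ p' ∈ R j c, dist1 (GaugeField.plaqHol V' p') < ε'' j) → chiFactor F N ν p g j c V' = 1)
    (α β C a₀ δ rate : ℕ → ℝ) (hα : ∀ j ∈ J, 0 < α j)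
    (hguard : ∀ j ∈ J, (((((F.P p.K).d + 2) * (F.P p.K).L : ℕ) : ℝ) ^ 2 / 4) * Real.sqrt (2 * (Fintype.card (Fin N) : ℝ) * α j) <
      deltaSU (Fin N))
    (hβ : ∀ j ∈ J, 0 ≤ β j) (hC : ∀ j ∈ J, 0 ≤ C j) (hδ0 : ∀ j ∈ J, 0 ≤ δ j)
    (hδ : ∀ j ∈ J, δ j * ((2 * (Fintype.card (Fin N) : ℝ) * (((F.P p.K).L : ℝ) ^ 2 + 6 * ((((F.P p.K).d + 2) * (F.P p.K).L : ℕ) : ℝ) ^ 2) ^ 2 +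
        2 / α j) * (((2 * (((F.P p.K).d + 3) * (F.P p.K).L + 2) + 1) ^ (F.P p.K).d * (F.P p.K).d ^ 2 : ℕ) : ℝ)) ≤ a₀ j)
    (hrate : ∀ j ∈ J, rate j = ((m j : ℝ) * Real.exp (C j * ((2 * (Fintype.card (Fin N) : ℝ) *
            (((F.P p.K).L : ℝ) ^ 2 + 6 * ((((F.P p.K).d + 2) * (F.P p.K).L : ℕ) : ℝ) ^ 2) ^ 2 + 2 / α j) *
          (((2 * (((F.P p.K).d + 3) * (F.P p.K).L + 2) + 1) ^ (F.P p.K).d * (F.P p.K).d ^ 2 : ℕ) : ℝ)) *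
          (((2 * (((F.P p.K).d + 3) * (F.P p.K).L + 2) + 1) ^ (F.P p.K).d * (F.P p.K).d ^ 2 : ℕ) : ℝ) * δ j -
            δ j * β j * (ε'' j ^ 2 / (2 * (Fintype.card (Fin N) : ℝ))))) ^ (D j).card)
    (hrate0 : ∀ j ∈ J, 0 < rate j)
    (K' : ℕ) (E : (j : ℕ) → (Fin j → LabelPat F ν p g) → Finset (LbOfRecord F ν p g j)) (hE : ∀ j ∈ J, ∀ h t, t ∈ E j h → D j ⊆ t.1)
    (hLSw : ∀ j ∈ J, j < K' → ∀ h : Fin j → LabelPat F ν p g,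
      h ∈ admS (labelTowerOfRecord F N ν M p g A₁ (zeta316OfRecord F N ν M A₁)) (labelPattern F ν p g E) j →
      D j ⊆ cubes32 F ν M p g j (seqOfHist F ν M p g j h) →
      ∀ a : ℝ, 0 ≤ a → a ≤ a₀ j → ∀ X : Finset (Plaq (F.P p.K) j),
        (∀ q ∈ X, ∃ c ∈ D j, ∃ p' ∈ R j c, q ∈ boxRegion (emb p'.src) (((F.P p.K).d + 3) * (F.P p.K).L + 2)) →
        ∫ U, Real.exp (a * β j * ∑ q ∈ X, (1 - reTr (GaugeField.plaqHol U q))) *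
            (labelTowerOfRecord F N ν M p g A₁ (zeta316OfRecord F N ν M A₁)).eterm ρ₀ j h U ∂(lawOfRecord F N p.K j) ≤
          Real.exp (C j * a * X.card) * ∫ U, (labelTowerOfRecord F N ν M p g A₁ (zeta316OfRecord F N ν M A₁)).eterm ρ₀ j h U ∂(lawOfRecord F N p.K j)) :
    PointwiseExtraction (labelTowerOfRecord F N ν M p g A₁ (zeta316OfRecord F N ν M A₁)) (labelPattern F ν p g E) K'
        (labelChi F N ν M p g A₁ (zeta316OfRecord F N ν M A₁))
        (fun j h U => if j ∈ J then (if D j ⊆ cubes32 F ν M p g j (seqOfHist F ν M p g j h) then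
          Set.indicator {U : cfgOfRecord F N p.K j |
            ∀ c ∈ D j, ∃ p' ∈ R j c, ε'' j ≤ dist1 (GaugeField.plaqHol ((avOfRecord F N p.K j).avg U) p')} (fun _ => (1 : ℝ)) U else 0) else 1)
        (fun _ _ => 0) ∧
      LocCondStability (labelTowerOfRecord F N ν M p g A₁ (zeta316OfRecord F N ν M A₁)) (labelPattern F ν p g E) K' (lawOfRecord F N p.K) ρ₀
        (fun j h U => if j ∈ J then (if D j ⊆ cubes32 F ν M p g j (seqOfHist F ν M p g j h) then
          Set.indicator {U : cfgOfRecord F N p.K j |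
            ∀ c ∈ D j, ∃ p' ∈ R j c, ε'' j ≤ dist1 (GaugeField.plaqHol ((avOfRecord F N p.K j).avg U) p')} (fun _ => (1 : ℝ)) U else 0) else 1)
        (fun j _ => if j ∈ J then Real.log (rate j) else 0) := by
  set T := labelTowerOfRecord F N ν M p g A₁ (zeta316OfRecord F N ν M A₁) with hT
  have hζu := isZetaUnity_zeta316OfRecord (F := F) (N := N) (ν := ν) (M := M) A₁
  have hζ := isZetaAbsLeOne_zeta316OfRecord (F := F) (N := N) (ν := ν) (M := M) A₁
  have hζ0 := zeta_nonneg_of_laws F N ν M hζu hζ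
  refine ⟨?_, ?_⟩
  · -- half (i), pointwise, at every level
    intro j h hj _ U
    rw [neg_zero, Real.exp_zero, one_mul, branch_inter_labelPattern, sum_labelPattern]
    dsimp only
    by_cases hjJ : j ∈ J
    · rw [if_pos hjJ]
      by_cases hwin : D j ⊆ cubes32 F ν M p g j (seqOfHist F ν M p g j h)
      · rw [if_pos hwin, Finset.sum_congr rfl fun t _ => by rw [labelChi_eq F N ν M p g A₁ hζu hζ, labelAt_mk]]
        have h1 := (le_abs_self _).trans (abs_sum_ωOfRecord_sub_le_indicator F N ν M p g j A₁ hζ hζ0 (seqOfHist F ν M p g j h) (D j) (E j h)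
          (hE j hjJ h) (R j) (ε'' j) (hreg j hjJ) U ((avOfRecord F N p.K j).avg U))
        refine h1.trans (le_of_eq ?_)
        by_cases hU : ∀ c ∈ D j, ∃ p' ∈ R j c, ε'' j ≤ dist1 (GaugeField.plaqHol ((avOfRecord F N p.K j).avg U) p')
        · rw [Set.indicator_of_mem (show (avOfRecord F N p.K j).avg U ∈ {V' : GaugeField (F.P p.K) (j + 1) (SU N) |
              ∀ c ∈ D j, ∃ p' ∈ R j c, ε'' j ≤ dist1 (GaugeField.plaqHol V' p')} from hU),
            Set.indicator_of_mem (show U ∈ {U : cfgOfRecord F N p.K j |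
              ∀ c ∈ D j, ∃ p' ∈ R j c, ε'' j ≤ dist1 (GaugeField.plaqHol ((avOfRecord F N p.K j).avg U) p')} from hU)]
        · rw [Set.indicator_of_notMem (show (avOfRecord F N p.K j).avg U ∉ {V' : GaugeField (F.P p.K) (j + 1) (SU N) |
              ∀ c ∈ D j, ∃ p' ∈ R j c, ε'' j ≤ dist1 (GaugeField.plaqHol V' p')} from hU),
            Set.indicator_of_notMem (show U ∉ {U : cfgOfRecord F N p.K j |
              ∀ c ∈ D j, ∃ p' ∈ R j c, ε'' j ≤ dist1 (GaugeField.plaqHol ((avOfRecord F N p.K j).avg U) p')} from hU)]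
      · -- off-window prefix: every pinned label weighs zero
        rw [if_neg hwin]
        refine le_of_eq (Finset.sum_eq_zero fun t ht => ?_)
        exact labelChi_eq_zero_of_not_subset_cubes32 F N ν M p g A₁ (zeta316OfRecord F N ν M A₁) hζu hζ j h hwin t (hE j hjJ h t ht) U
    · rw [if_neg hjJ, Finset.sum_congr rfl fun t _ => by rw [labelChi_eq F N ν M p g A₁ hζu hζ, labelAt_mk]]
      have h1 := sum_ωOfRecord_sub_le F N ν M p g j A₁ hζ hζ0 (seqOfHist F ν M p g j h) ∅ (E j h) (fun _ _ => Finset.empty_subset _) U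
        ((avOfRecord F N p.K j).avg U)
      simpa using h1.2
  · -- half (ii), at every level
    intro j h hj hadm
    have hegood : (bddMeas (cfgOfRecord F N p.K j)).Gd (T.eterm ρ₀ j h) := T.eterm_good hρ j h
    have he0 : ∀ U, 0 ≤ T.eterm ρ₀ j h U := fun U => T.eterm_nonneg hρ h0 j h U
    have heint : Integrable (T.eterm ρ₀ j h) (lawOfRecord F N p.K j) := integrable_of_bddMeas _ hegood
    by_cases hjJ : j ∈ J
    · simp only [if_pos hjJ]
      by_cases hwin : D j ⊆ cubes32 F ν M p g j (seqOfHist F ν M p g j h)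
      · simp only [if_pos hwin]
        set S : Set (cfgOfRecord F N p.K j) :=
          {U | ∀ c ∈ D j, ∃ p' ∈ R j c, ε'' j ≤ dist1 (GaugeField.plaqHol ((avOfRecord F N p.K j).avg U) p')} with hS
        have hSm : MeasurableSet S :=
          (measurableSet_forall_exists_largeField F N ν p g j (D j) (R j) (ε'' j)).preimage (avOfRecord_measurable F N p.K j)
        have hind : ∀ U, S.indicator (fun _ => (1 : ℝ)) U * T.eterm ρ₀ j h U = S.indicator (T.eterm ρ₀ j h) U := by
          intro U
          by_cases hU : U ∈ S
          · simp only [Set.indicator_of_mem hU, one_mul]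
          · simp only [Set.indicator_of_notMem hU, zero_mul]
        refine ⟨(heint.indicator hSm).congr (ae_of_all _ fun U => (hind U).symm), ?_⟩
        rw [integral_congr_ae (ae_of_all _ hind), integral_indicator hSm, Real.exp_log (hrate0 j hjJ), hrate j hjJ]
        exact setIntegral_event_eterm_le_of_LCS_hull F N ν M p g j (hJ j hjJ) (hα j hjJ) (hguard j hjJ) hρ h0 h (hβ j hjJ) (hC j hjJ) (D j) (R j)
          (hLSw j hjJ hj h hadm hwin) (hδ0 j hjJ) (hδ j hjJ) (m j) (hε j hjJ) (hm j hjJ) (hdisj j hjJ)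
      · -- off-window prefix: the zero carrier
        simp only [if_neg hwin, zero_mul, integral_zero]
        exact ⟨integrable_zero _ _ _, mul_nonneg (Real.exp_pos _).le (integral_nonneg he0)⟩
    · simp only [if_neg hjJ, one_mul, Real.exp_zero]
      exact ⟨heint, le_rfl⟩

end Halves

end Summit.QuantumFields.YangMills.BalabanUVNodes.N20LCSHullHalves

end
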